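import Literature.NumberTheory.EllipticCurves.Kato2004.IwasawaCohomologyNumberFieldIsogeny
import Literature.NumberTheory.EllipticCurves.Kato2004.EulerSystemIsogenyTransport
import HarnessLib

set_option autoImplicit false

/-!
# `𝒞₇` genus road (crux `EllipticUnitValueSevenOfGZK`, K7r), pen D1126/D1128 rows (T1)+(T3): the PARTNER TRANSPORT of the
# `K`-side pinned Iwasawa cohomology along a prime-to-`p` isogeny pair — TRANSPORT OF STRUCTURE on the SAME carrier
# (critic idea-crit-15 g18 NOTE #15 (1)): `IK₂ := IK` with `proj₂ n := β_* ∘ proj n`, and `β_*` becomes the identity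

Cell bsd-cm, seat bsd-cm-k-ty1 g34 (literature-prover; OWNER of (S-D-★′), zp v20 a4ba175e5009387e; pen bsd-cm-plan g39
D1124–D1128).  PURE KERNEL (one `def` with a body + theorems): no named fact, no `sorry`, no `instance`, no notation; everything
landed is untouched.  GENERAL: any number field `K`, Weierstrass curves `V, V′/K`, any prime `p`, any `ℤ_p`-extension `κ` of `K`
with generator `γ`, any `K`-isogeny pair `β : V → V′`, `α : V′ → V` with `α ∘ β = [e] = β ∘ α` and `e` a `p`-ADIC UNIT (on
`𝒞₇`: `p = 7`, `e ∈ {1, 2}`).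

WHY (pen D1126, the prover-side AUDIT-W5(a) finding of `SD-PROVER-JUNCTION-W5a.md`): F-P1
(`CM.kato15161_ellipticUnitClass_res_zetaFamily`) is printed for the MAXIMAL-order curve and quantifies over a `K`-side pin
`IK₂ : IwasawaH1DataOver (W₂.baseChange Kcm) …`, while the (S-D-★′) stub displays the member's pin `IK`.  Since `T_pβ`,
`T_pα` are isomorphisms up to the unit `e`, the member's pin TRANSPORTS to a pin of the partner ON THE SAME `Λ`-MODULE
`IK.H`: `(IK.transport β α …).proj n := β_* ∘ IK.proj n` — integral (`isogenyLayerMapK_mem_integralH1K`), norm-compatible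
(`isogenyLayerMapK_layerCoresOver`), injective and surjective onto the partner's norm-compatible integral families (through
`α_*` and `e⁻¹`), with the SAME `Λ`-action (`β_*` intertwines `conj_γ − 1` and the constants).  Then the abstract push-forward
`IK.isogenyMap β (IK.transport …)` of `IwasawaCohomologyNumberFieldIsogeny.lean` IS THE IDENTITY of `IK.H` and
`(IK.transport …).isogenyMap α IK` is multiplication by `e` ((T3) collapses, as NOTE #15 (1) predicted), so F-P1 ∀-eliminated
at `IK₂ := IK.transport …` speaks about the member's own carrier.  §4 is the `ℚ`-side twin (T2) for `IwasawaH1Data W p κ γ`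
along a `ℚ`-isogeny pair (`isogenyMapH1` of `EulerSystemIsogenyTransport.lean`; the one missing levelwise input, «`φ_*`
preserves `integralH1`», is proved here from `isogenyMapH1_resLe`).  The `res`-square (T4) between the two transported pins and
the realised-family transport (T5) are the successor's rows (HANDOFF §).

## Contents
* §1 `PartnerTransport.unitsSMul_*` helpers: `(e : ℤ) • c = (u : ℤ_p) • c` and cancellation by the unit `u`.
* §2 ★ `IwasawaH1DataOver.transport IK β α e u hu hαβ hβα : IwasawaH1DataOver V′ p κ γ` (carrier `IK.H`), `transport_proj`
  (`rfl`), `transport_H` (`rfl`).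
* §3 (T3) `isogenyMap_transport_eq_self : IK.isogenyMap β (IK.transport …) hγ x = x`,
  `transport_isogenyMap_eq_C_smul : (IK.transport …).isogenyMap α IK hγ x = C u • x`, and their composite.
* §4 (T2) the `ℚ`-side twin: `isogenyMapH1_mem_integralH1`, `isogenyMapH1_layerCores`, ★ `transportQ I β α e u … :
  IwasawaH1Data W′ p κ γ` (carrier `I.H`, `proj₂ n := β_* ∘ I.proj n`), `transportQ_proj` (`rfl`).

HONEST LABEL: kernel plumbing (functoriality of continuous cohomology along an isogeny whose degree is prime to `p`); nothing
about Kato's values or BSD is proved; stmt-BirchSwinnertonDyer-19945 stays OPEN (zp v20, 5 sorries); `X12.CMRamifiedSeven` is NOT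
proved; no summit statement is proved; BSD is claimed for no curve.

## References
* K. Kato, Astérisque 295 (2004), §8.1 (8.1.3) (p. 180), §12.2 (p. 220), Ex. 13.3 (p. 225), 15.14 (p. 264). [Kato2004Asterisque]
* K. Rubin, *Euler Systems* (2000), App. B §2–§3. [Rubin2000]
* J.-P. Serre, *Galois Cohomology* (1997), I §2.2, §2.4. [SerreGaloisCohomology1997]
* J. H. Silverman, *AEC* (2009), III.6.1, III.7.4. [SilvermanAEC2009]
-/

noncomputable section

open scoped NumberField
open Polynomial
open Field IsDedekindDomain NumberField
open Literature.NumberTheory.GaloisRepresentations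
open Literature.NumberTheory.EllipticCurves
open Literature.NumberTheory.EllipticCurves.IwasawaAlgebra
open Literature.NumberTheory.EllipticCurves.Kato2004
open Literature.NumberTheory.EllipticCurves.Kato2004.CM (tateRepK integralH1K mem_integralH1K_iff)
open Literature.NumberTheory.EllipticCurves.Kato2004.EulerSystemValues (tateRep)

namespace Summit.BirchSwinnertonDyer.Rank1Residual.Additive.GenusSeven

namespace PartnerTransport

variable {K : Type} [Field K] {V V' : WeierstrassCurve K} {p : ℕ} [Fact p.Prime]
  [ContinuousSMul ℤ_[p] (V.tateModule p)] [ContinuousSMul ℤ_[p] (V'.tateModule p)]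
  {κ : ZpExtension K p} {γ : absoluteGaloisGroup K}

/-! ## §1 Scalars: the integer `e` read as the `p`-adic unit `u` -/

/-- `(e : ℤ) • c = (u : ℤ_p) • c` on any `ℤ_p`-module when `(u : ℤ_p) = e`. [folklore] -/
theorem zsmul_eq_units_smul {M : Type*} [AddCommGroup M] [Module ℤ_[p] M] {e : ℤ} {u : ℤ_[p]ˣ}
    (hu : (u : ℤ_[p]) = e) (c : M) : (e : ℤ) • c = (u : ℤ_[p]) • c := by
  rw [hu, Int.cast_smul_eq_zsmul]

/-- Cancellation by the unit: `u⁻¹ • (e • c) = c`. [folklore] -/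
theorem units_inv_smul_zsmul {M : Type*} [AddCommGroup M] [Module ℤ_[p] M] {e : ℤ} {u : ℤ_[p]ˣ}
    (hu : (u : ℤ_[p]) = e) (c : M) : ((u⁻¹ : ℤ_[p]ˣ) : ℤ_[p]) • ((e : ℤ) • c) = c := by
  rw [zsmul_eq_units_smul hu, ← mul_smul, Units.inv_mul, one_smul]

/-- `e • c = 0 ⇒ c = 0` when `e` is a `p`-adic unit. [folklore] -/
theorem eq_zero_of_zsmul_eq_zero {M : Type*} [AddCommGroup M] [Module ℤ_[p] M] {e : ℤ} {u : ℤ_[p]ˣ}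
    (hu : (u : ℤ_[p]) = e) {c : M} (h : (e : ℤ) • c = 0) : c = 0 := by
  rw [← units_inv_smul_zsmul hu c, h, smul_zero]

/-! ## §2 ★ The transported pin `IK₂ := (IK.H, β_* ∘ proj)` -/

/-- ★ **TRANSPORT OF THE `K`-SIDE PIN ALONG A PRIME-TO-`p` ISOGENY PAIR** (critic NOTE #15 (1), pen D1128): for
`β : V → V′`, `α : V′ → V` with `α ∘ β = [e]`, `β ∘ α = [e]`, `e = u ∈ ℤ_pˣ`, the datum `IwasawaH1DataOver V′ p κ γ` whose
carrier IS `IK.H` and whose layer projections are `β_* ∘ IK.proj n` — integral (`isogenyLayerMapK_mem_integralH1K`),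
norm-compatible (`isogenyLayerMapK_layerCoresOver`), jointly injective (`α_* β_* = e`, `e` a unit), surjective onto the
norm-compatible integral families of `V′` (pull back by `u⁻¹·α_*`), with `X ↦ conj_γ − 1` and the constants transported by the
equivariance / linearity of `β_*`. [cite: Kato2004Asterisque, §12.2 (p. 220) and Ex. 13.3 (p. 225)] [cite: Rubin2000, App. B §3] -/
def transport (IK : IwasawaH1DataOver V p κ γ) (β : WeierstrassCurve.Isogeny V V') (α : WeierstrassCurve.Isogeny V' V)
    (e : ℤ) (u : ℤ_[p]ˣ) (hu : (u : ℤ_[p]) = e) (hαβ : ∀ P, α (β P) = e • P) (hβα : ∀ P, β (α P) = e • P) :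
    IwasawaH1DataOver V' p κ γ where
  H := IK.H
  proj n := (isogenyLayerMapK p β (κ.layerSubgroup n)).toAddMonoidHom.comp (IK.proj n)
  proj_mem n x := isogenyLayerMapK_mem_integralH1K p β _ (IK.proj_mem n x)
  cores_proj n x := by
    change layerCoresOver (tateRepK V' p) κ n (isogenyLayerMapK p β _ (IK.proj (n + 1) x)) =
      isogenyLayerMapK p β _ (IK.proj n x)
    rw [← isogenyLayerMapK_layerCoresOver, IK.cores_proj]
  proj_injective x hx := IK.proj_injective x fun n ↦ by
    have h := congrArg (isogenyLayerMapK p α (κ.layerSubgroup n)) (hx n)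
    rw [map_zero] at h
    change isogenyLayerMapK p α _ (isogenyLayerMapK p β _ (IK.proj n x)) = 0 at h
    rw [isogenyLayerMapK_isogenyLayerMapK_of_comp_eq_zsmul p β α hαβ] at h
    exact eq_zero_of_zsmul_eq_zero hu h
  proj_surjective y hy := by
    -- pull the family back to `V` by `u⁻¹ · α_*`
    set y' : ∀ n : ℕ, H1 (tateRepK V p) (κ.layerSubgroup n) :=
      fun n ↦ ((u⁻¹ : ℤ_[p]ˣ) : ℤ_[p]) • isogenyLayerMapK p α (κ.layerSubgroup n) (y n) with hy'
    have hy'nc : IsNormCompatibleOver (tateRepK V p) κ y' := by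
      refine ⟨fun n ↦ ?_, fun n ↦ ?_⟩
      · exact (integralH1K (tateRepK V p) p (κ.layerSubgroup n)).smul_mem _
          (isogenyLayerMapK_mem_integralH1K p α _ (hy.1 n))
      · simp only [hy', map_smul, ← isogenyLayerMapK_layerCoresOver, hy.2 n]
    obtain ⟨x, hx⟩ := IK.proj_surjective y' hy'nc
    refine ⟨x, fun n ↦ ?_⟩
    change isogenyLayerMapK p β _ (IK.proj n x) = y n
    rw [hx n, hy', map_smul, isogenyLayerMapK_isogenyLayerMapK_of_comp_eq_zsmul p α β hβα,
      units_inv_smul_zsmul hu]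
  proj_T_smul n x := by
    change isogenyLayerMapK p β _ (IK.proj n ((PowerSeries.X : IwasawaAlgebra p) • x)) =
      conjMap (tateRepK V' p).toTopRep (κ.layerSubgroup n) γ 1 (isogenyLayerMapK p β _ (IK.proj n x)) -
        isogenyLayerMapK p β _ (IK.proj n x)
    rw [IK.proj_T_smul, map_sub, isogenyLayerMapK_conjMap]
  proj_C_smul c n x := by
    change isogenyLayerMapK p β _ (IK.proj n (PowerSeries.C c • x)) = c • isogenyLayerMapK p β _ (IK.proj n x)
    rw [IK.proj_C_smul, map_smul]

variable (IK : IwasawaH1DataOver V p κ γ) (β : WeierstrassCurve.Isogeny V V') (α : WeierstrassCurve.Isogeny V' V)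
  (e : ℤ) (u : ℤ_[p]ˣ) (hu : (u : ℤ_[p]) = e) (hαβ : ∀ P, α (β P) = e • P) (hβα : ∀ P, β (α P) = e • P)

/-- The carrier of the transported pin IS `IK.H`. [cite: Kato2004Asterisque, §12.2 (p. 220)] -/
theorem transport_H : (transport IK β α e u hu hαβ hβα).H = IK.H := rfl

/-- The layer projections of the transported pin are `β_* ∘ proj`. [cite: Kato2004Asterisque, §12.2 (p. 220)] -/
theorem transport_proj (n : ℕ) (x : IK.H) :
    (transport IK β α e u hu hαβ hβα).proj n x = isogenyLayerMapK p β (κ.layerSubgroup n) (IK.proj n x) := rfl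

/-! ## §3 (T3) The push-forwards to / from the transported pin are the identity / multiplication by `e` -/

/-- ★ (T3) **`β_*` to the transported pin is the identity of the carrier**: `IK.isogenyMap β (IK.transport β α …) hγ x = x`
(both have the layers `β_* (proj n x)`; `proj` is jointly injective). [cite: Kato2004Asterisque, §12.2 (p. 220)] -/
theorem isogenyMap_transport_eq_self (hγ : κ.IsTopGenerator γ) (x : IK.H) :
    IK.isogenyMap β (transport IK β α e u hu hαβ hβα) hγ x = (x : IK.H) :=
  (transport IK β α e u hu hαβ hβα).proj_eq_iff.mp fun n ↦ by
    rw [IwasawaH1DataOver.proj_isogenyMap]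
    rfl

/-- (T3) **`α_*` from the transported pin back to `IK` is multiplication by `e`** (read as the constant `C u ∈ Λ`):
`(IK.transport …).isogenyMap α IK hγ x = C u • x`. [cite: Kato2004Asterisque, §12.2 (p. 220)] [cite: SilvermanAEC2009, III.6.1] -/
theorem transport_isogenyMap_eq_C_smul (hγ : κ.IsTopGenerator γ) (x : IK.H) :
    (transport IK β α e u hu hαβ hβα).isogenyMap α IK hγ x = (PowerSeries.C (u : ℤ_[p]) : IwasawaAlgebra p) • (x : IK.H) :=
  IK.proj_eq_iff.mp fun n ↦ by
    rw [IwasawaH1DataOver.proj_isogenyMap, transport_proj, IK.proj_C_smul,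
      isogenyLayerMapK_isogenyLayerMapK_of_comp_eq_zsmul p β α hαβ, zsmul_eq_units_smul hu]

/-- (T3) In particular `α_* ∘ β_*` through the transported pin is `C u •` and `β_*` after `α_*` likewise: the two
push-forwards compose to the unit scalar `e`. [cite: SilvermanAEC2009, III.6.1] -/
theorem isogenyMap_transport_isogenyMap (hγ : κ.IsTopGenerator γ) (x : IK.H) :
    (transport IK β α e u hu hαβ hβα).isogenyMap α IK hγ (IK.isogenyMap β (transport IK β α e u hu hαβ hβα) hγ x) =
      (PowerSeries.C (u : ℤ_[p]) : IwasawaAlgebra p) • x := by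
  rw [isogenyMap_transport_eq_self, transport_isogenyMap_eq_C_smul]

/-! ## §4 (T2) The `ℚ`-side twin: transport of `IwasawaH1Data W p κ γ` along a prime-to-`p` `ℚ`-isogeny pair -/

section RationalSide

variable {W W' : WeierstrassCurve ℚ} [W.IsElliptic] [W'.IsElliptic] {p : ℕ} [Fact p.Prime]
  [ContinuousSMul ℤ_[p] (W.tateModule p)] [ContinuousSMul ℤ_[p] (W'.tateModule p)]
  {κ : ZpExtension ℚ p} {γ : absoluteGaloisGroup ℚ}

/-- **`φ_*` preserves the integral classes `H¹(ℤ_n[1/p], T)`** (`integralH1`: vanishing of the restriction to `U ⊓ I_𝔓` for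
the primes `𝔓` over `v ≠ p` — `φ_*` commutes with that restriction, `isogenyMapH1_resLe`).
[cite: Kato2004Asterisque, §8.1 (8.1.3) (p. 180) and §8.2, Lemma 8.5 (pp. 180–184)] -/
theorem isogenyMapH1_mem_integralH1 (φ : WeierstrassCurve.Isogeny W W') (U : Subgroup (absoluteGaloisGroup ℚ))
    {c : H1 (tateRep W p) U} (hc : c ∈ integralH1 (tateRep W p) p U) :
    isogenyMapH1 p φ U c ∈ integralH1 (tateRep W' p) p U := by
  rw [mem_integralH1_iff] at hc ⊢
  intro v hv 𝔓 h𝔓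
  rw [← isogenyMapH1_resLe, hc v hv 𝔓 h𝔓, map_zero]

/-- `φ_*` commutes with the layer trace maps `Cor : H¹(ℚ_{n+1}, T) → H¹(ℚ_n, T)` of the `ℤ_p`-extension `κ`.
[cite: Kato2004Asterisque, §12.2 (p. 220)] [cite: SerreGaloisCohomology1997, I §2.4] -/
theorem isogenyMapH1_layerCores (φ : WeierstrassCurve.Isogeny W W') (n : ℕ)
    (c : H1 (tateRep W p) (κ.layerSubgroup (n + 1))) :
    isogenyMapH1 p φ (κ.layerSubgroup n) (layerCores (tateRep W p) κ n c) =
      layerCores (tateRep W' p) κ n (isogenyMapH1 p φ (κ.layerSubgroup (n + 1)) c) := by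
  haveI : (κ.layerSubgroup (n + 1)).FiniteIndex :=
    finiteIndex_of_isOpen_of_compactSpace _ (κ.isOpen_layerSubgroup (n + 1))
  letI : Fintype (κ.layerSubgroup n ⧸ (κ.layerSubgroup (n + 1)).subgroupOf (κ.layerSubgroup n)) :=
    Fintype.ofFinite _
  exact isogenyMapH1_coresLe p φ _ _ c

/-- ★ (T2) **TRANSPORT OF THE `ℚ`-SIDE PIN ALONG A PRIME-TO-`p` `ℚ`-ISOGENY PAIR**: for `β : W → W′`, `α : W′ → W` with
`α ∘ β = [e]`, `β ∘ α = [e]`, `e = u ∈ ℤ_pˣ`, the datum `IwasawaH1Data W′ p κ γ` whose carrier IS `I.H` and whose layer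
projections are `β_* ∘ I.proj n` (the `ℚ`-side twin of `transport`). [cite: Kato2004Asterisque, §12.2 (p. 220) and Ex. 13.3 (p. 225)]
[cite: Rubin2000, App. B §3] -/
def transportQ (I : IwasawaH1Data W p κ γ) (β : WeierstrassCurve.Isogeny W W') (α : WeierstrassCurve.Isogeny W' W)
    (e : ℤ) (u : ℤ_[p]ˣ) (hu : (u : ℤ_[p]) = e) (hαβ : ∀ P, α (β P) = e • P) (hβα : ∀ P, β (α P) = e • P) :
    IwasawaH1Data W' p κ γ where
  H := I.H
  proj n := (isogenyMapH1 p β (κ.layerSubgroup n)).toAddMonoidHom.comp (I.proj n)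
  proj_mem n x := isogenyMapH1_mem_integralH1 β _ (I.proj_mem n x)
  cores_proj n x := by
    change layerCores (tateRep W' p) κ n (isogenyMapH1 p β _ (I.proj (n + 1) x)) = isogenyMapH1 p β _ (I.proj n x)
    rw [← isogenyMapH1_layerCores, I.cores_proj]
  proj_injective x hx := I.proj_injective x fun n ↦ by
    have h := congrArg (isogenyMapH1 p α (κ.layerSubgroup n)) (hx n)
    rw [map_zero] at h
    change isogenyMapH1 p α _ (isogenyMapH1 p β _ (I.proj n x)) = 0 at h
    rw [isogenyMapH1_isogenyMapH1_of_comp_eq_zsmul p β α hαβ] at h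
    exact eq_zero_of_zsmul_eq_zero hu h
  proj_surjective y hy := by
    set y' : ∀ n : ℕ, H1 (tateRep W p) (κ.layerSubgroup n) :=
      fun n ↦ ((u⁻¹ : ℤ_[p]ˣ) : ℤ_[p]) • isogenyMapH1 p α (κ.layerSubgroup n) (y n) with hy'
    have hy'nc : IsNormCompatible (tateRep W p) κ y' := by
      refine ⟨fun n ↦ ?_, fun n ↦ ?_⟩
      · exact (integralH1 (tateRep W p) p (κ.layerSubgroup n)).smul_mem _ (isogenyMapH1_mem_integralH1 α _ (hy.1 n))
      · simp only [hy', map_smul, ← isogenyMapH1_layerCores, hy.2 n]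
    obtain ⟨x, hx⟩ := I.proj_surjective y' hy'nc
    refine ⟨x, fun n ↦ ?_⟩
    change isogenyMapH1 p β _ (I.proj n x) = y n
    rw [hx n, hy', map_smul, isogenyMapH1_isogenyMapH1_of_comp_eq_zsmul p α β hβα, units_inv_smul_zsmul hu]
  proj_T_smul n x := by
    change isogenyMapH1 p β _ (I.proj n ((PowerSeries.X : IwasawaAlgebra p) • x)) =
      conjMap (tateRep W' p).toTopRep (κ.layerSubgroup n) γ 1 (isogenyMapH1 p β _ (I.proj n x)) -
        isogenyMapH1 p β _ (I.proj n x)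
    rw [I.proj_T_smul, map_sub, isogenyMapH1_conjMap]
  proj_C_smul c n x := by
    change isogenyMapH1 p β _ (I.proj n (PowerSeries.C c • x)) = c • isogenyMapH1 p β _ (I.proj n x)
    rw [I.proj_C_smul, map_smul]

/-- The layer projections of the transported `ℚ`-side pin are `β_* ∘ proj` (and its carrier is `I.H` by `rfl`).
[cite: Kato2004Asterisque, §12.2 (p. 220)] -/
theorem transportQ_proj (I : IwasawaH1Data W p κ γ) (β : WeierstrassCurve.Isogeny W W') (α : WeierstrassCurve.Isogeny W' W)
    (e : ℤ) (u : ℤ_[p]ˣ) (hu : (u : ℤ_[p]) = e) (hαβ : ∀ P, α (β P) = e • P) (hβα : ∀ P, β (α P) = e • P)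
    (n : ℕ) (x : I.H) :
    (transportQ I β α e u hu hαβ hβα).proj n x = isogenyMapH1 p β (κ.layerSubgroup n) (I.proj n x) := rfl

end RationalSide

end PartnerTransport

end Summit.BirchSwinnertonDyer.Rank1Residual.Additive.GenusSeven

end
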